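import Literature.NumberTheory.Automorphic.SmoothedCuspForms
import HarnessLib

/-!
# Siegel-type pointwise estimates pass from continuous cusp forms to `L²_cusp`
(folklore; Garrett (2018), §7.3; Getz–Hahn (2024), §9.3, §9.6)

A brick of the basic estimate for cusp forms on a Siegel set
(`GLnCuspidalSpectrum.norm_smoothedForm_le_of_isSiegelSetGL` of `GLnCuspidalSpectrumSiegel`,
Garrett Thm. 7.3.10 / Getz–Hahn Prop. 9.6.1). The printed proofs manipulate genuine functions —
continuous cusp forms, whose constant terms vanish pointwise — while the named fact quantifies
over the closure `cuspidalSubspace n K μ` of their image in `L²`. This file supplies the passage: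

* `norm_smoothedForm_le_of_forall_mem_range_cuspFormsToLp` — if `|R(η) f (x)| ≤ C ‖f‖₂` for the
  `L²`-classes `f` of all continuous square-integrable cusp forms (`cuspFormsToLp` of
  `GLnCuspidalSpectrum`), then the same bound holds for every `f ∈ L²_cusp`: along a sequence
  `f_k → f` from the range, `R(η) f_k (x) → R(η) f (x)`, because evaluation of `R(η) f` at a point
  is `L²`-bounded (`exists_norm_smoothedForm_le` of `SmoothedCuspForms`) and additive
  (`smoothedForm_sub`).
* `norm_smoothedForm_le_on_of_forall_mem_range_cuspFormsToLp` — the same with a set of points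
  (a Siegel set) quantified inside, the form of the named fact.

## References

* P. Garrett, *Modern Analysis of Automorphic Forms by Example* (2018), §7.3, Thm. 7.3.10
  [Garrett2018].
* J. R. Getz, H. Hahn, *An Introduction to Automorphic Representations* (2024), §9.3, Prop. 9.6.1
  [GetzHahn2024].
-/

noncomputable section

open MeasureTheory Measure Set Filter Topology IsDedekindDomain NumberField

namespace Literature.NumberTheory.Automorphic

variable {n : ℕ} {K : Type} [Field K] [NumberField K]
  {μ : Measure (AdelicGroupData.gl n K).automorphicQuotient}
  [(AdelicGroupData.gl n K).IsAutomorphicMeasure μ]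

attribute [local instance] adelicBorel borelSpace_adelic locallyCompactSpace_adelic
  secondCountableTopology_gl_adelic

/-- **Evaluation of `R(η) f` at a point is continuous on `L²`**: for a continuous compactly
supported weight `η` and a point `x`, `f ↦ R(η) f (x) = smoothedForm η f x` is continuous on
`L²(GL_n(𝔸_K) ⧸ A_G GL_n(K), μ)` (it is additive, `smoothedForm_sub`, and bounded,
`exists_norm_smoothedForm_le` of `SmoothedCuspForms` on the compact `{θ}`, `x = θ • x₀`).
[folklore] -/
theorem continuous_smoothedForm_apply {η : (AdelicGroupData.gl n K).Adelic → ℝ}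
    (hη : Continuous η) (hηs : HasCompactSupport η)
    (x : (AdelicGroupData.gl n K).automorphicQuotient) :
    Continuous fun f : (AdelicGroupData.gl n K).L2 μ => smoothedForm η f x := by
  obtain ⟨θ, rfl⟩ := surjective_smul_basePoint n K x
  obtain ⟨C, hC0, hC⟩ := exists_norm_smoothedForm_le (μ := μ) hη hηs
    (isCompact_singleton (x := θ))
  refine continuous_iff_continuousAt.2 fun f₀ => ?_
  rw [ContinuousAt, tendsto_iff_norm_sub_tendsto_zero]
  have hb : ∀ f : (AdelicGroupData.gl n K).L2 μ,
      ‖smoothedForm η f (θ • basePoint n K) - smoothedForm η f₀ (θ • basePoint n K)‖ ≤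
        C * ‖f - f₀‖ := by
    intro f
    rw [← smoothedForm_sub hη hηs f f₀]
    exact hC _ θ rfl
  refine squeeze_zero (fun f => norm_nonneg _) hb ?_
  have h : Tendsto (fun f : (AdelicGroupData.gl n K).L2 μ => C * ‖f - f₀‖) (𝓝 f₀) (𝓝 (C * 0)) :=
    ((tendsto_iff_norm_sub_tendsto_zero.1 tendsto_id).const_mul C)
  rwa [mul_zero] at h

/-- **Density: Siegel-type pointwise estimates pass from continuous cusp forms to `L²_cusp`.**
Let `η` be a continuous compactly supported weight on `GL_n(𝔸_K)` and `x` a point of the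
automorphic quotient. If `|R(η) f (x)| ≤ C ‖f‖₂` for the `L²`-classes `f` of all continuous
square-integrable cusp forms (`f ∈ range (cuspFormsToLp n K μ)`), then the same bound holds for
every `f` in the cuspidal subspace `L²_cusp = closure (range cuspFormsToLp)`
(`cuspidalSubspace n K μ`): both sides are continuous in `f` (`continuous_smoothedForm_apply`) and
the inequality is a closed condition. This reduces the basic estimate on a Siegel set (Garrett
(2018), Thm. 7.3.10; Getz–Hahn (2024), Prop. 9.6.1), stated for `L²_cusp`, to genuine continuous
cusp forms with pointwise vanishing constant terms. [folklore] -/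
theorem norm_smoothedForm_le_of_forall_mem_range_cuspFormsToLp
    {η : (AdelicGroupData.gl n K).Adelic → ℝ} (hη : Continuous η) (hηs : HasCompactSupport η)
    {x : (AdelicGroupData.gl n K).automorphicQuotient} {C : ℝ}
    (h : ∀ f : (AdelicGroupData.gl n K).L2 μ, f ∈ LinearMap.range (cuspFormsToLp n K μ) →
      ‖smoothedForm η f x‖ ≤ C * ‖f‖)
    {f : (AdelicGroupData.gl n K).L2 μ} (hf : f ∈ cuspidalSubspace n K μ) :
    ‖smoothedForm η f x‖ ≤ C * ‖f‖ := by
  have hf' : f ∈ closure ((LinearMap.range (cuspFormsToLp n K μ) :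
      Submodule ℂ ((AdelicGroupData.gl n K).L2 μ)) : Set ((AdelicGroupData.gl n K).L2 μ)) := by
    rw [← Submodule.topologicalClosure_coe]
    exact hf
  have hclosed : IsClosed {f : (AdelicGroupData.gl n K).L2 μ | ‖smoothedForm η f x‖ ≤ C * ‖f‖} :=
    isClosed_le (continuous_smoothedForm_apply hη hηs x).norm (continuous_const.mul continuous_norm)
  exact (hclosed.closure_subset_iff.2 fun g hg => h g hg) hf'

/-- **Density, Siegel-set form**: if for a set `S ⊆ GL_n(𝔸_K)` (a Siegel set) and a weight `η`
the bound `|R(η) f ([s⁻¹])| ≤ C ‖f‖₂`, `s ∈ S`, holds for the `L²`-classes of all continuous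
square-integrable cusp forms, it holds for all `f ∈ L²_cusp` — the quantifier pattern of the named
fact `GLnCuspidalSpectrum.norm_smoothedForm_le_of_isSiegelSetGL`. [folklore] -/
theorem norm_smoothedForm_le_on_of_forall_mem_range_cuspFormsToLp
    {η : (AdelicGroupData.gl n K).Adelic → ℝ} (hη : Continuous η) (hηs : HasCompactSupport η)
    {S : Set (AdelicGroupData.gl n K).Adelic} {C : ℝ}
    (h : ∀ f : (AdelicGroupData.gl n K).L2 μ, f ∈ LinearMap.range (cuspFormsToLp n K μ) →
      ∀ s ∈ S, ‖smoothedForm η f ((AdelicGroupData.gl n K).toAutomorphicQuotient s⁻¹)‖ ≤ C * ‖f‖)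
    {f : (AdelicGroupData.gl n K).L2 μ} (hf : f ∈ cuspidalSubspace n K μ) {s : (AdelicGroupData.gl n K).Adelic}
    (hs : s ∈ S) :
    ‖smoothedForm η f ((AdelicGroupData.gl n K).toAutomorphicQuotient s⁻¹)‖ ≤ C * ‖f‖ :=
  norm_smoothedForm_le_of_forall_mem_range_cuspFormsToLp hη hηs (fun g hg => h g hg s hs) hf

end Literature.NumberTheory.Automorphic
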